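import Summits.QuantumFields.BalabanUV.Beta.EriceRemainderEnclosureHistoryAutonomyComparisonInvCubeConvex

/-!
# EriceRemainderEnclosureHistoryAutonomyComparisonTotalLoad — (E70d) THE TOTAL LOAD IS THE LOGARITHM OF THE CUBE-SECANT GROWTH:
# along every positive solution of the affine-memory flow (`b > 0`, `L ≥ 0` supported below `K`), with `F_m = 1∕h_m³` and the loads `x_k = L_k·k·h_k³∕2`,
# **`Σ_{1≤k≤n} x_k ≤ (√2∕2)·(1 + log( ((F_n − F_0)∕n) ∕ (F_1 − F_0) ))`** — Abel summation of the cumulative acceleration bound `Σ_{k≤m} L_k ≤ √2·(F_m − F_0)∕m`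
# against the secant slopes `(F_m − F_0)∕m`, which are NON-DECREASING by (E70a)'s convexity of `1∕h³`; on a memory-dominated stretch (levels `∝ m^{2∕3}`,
# `F` linear) the total load is therefore BOUNDED, on a floor-dominated one (`F ∝ m^{3∕2}`) it grows like `(√2∕4)·log n`

Cell `pub-balaban`, β-function sub-cell, BINDER row D4 «RemainderConst leaves for Bałaban's split» (`HOME/BINDER-OWNERS.md`; owner lineage `b2b-balaban-beta-an4`;
this file by co-owner #2 lineage `b2b-balaban-beta-d4-p2`, generation 60), β-FLOW TEAM duty (1), FREEZE (0) honoured (def-free; (E70a)'s `mono_of_pflow`,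
`sq_incr_anti`, `cube_secant`, `pflow_of_memFlow` BY NAME; nothing restated).

HONEST FRAMING (page 1, verbatim and binding).  *"Discharging BetaPertH makes Bałaban's UV stability UNCONDITIONAL — a real constructive-QFT result; it is
NOT the continuum limit and NOT the Clay problem."*  THIS FILE DISCHARGES NOTHING OF THE KIND.  Elementary real analysis about ABSTRACT affine functionals on
positive sequences — hypotheses of a census, not facts; the form, signs, ages and moments of Bałaban's (1.22) limit functional are NOT PRINTED ([I] p. 298;
GAPS G-t4-U2-1∕-2) and NOT asserted.  Row D4 class UNCHANGED (critical-path width 0; instance 0∕1; D4 DISCHARGE NO DATE).  HONEST DEPENDENCY: continuum YM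
on T⁴ ⇐ BetaPertH ∧ nine spine estimates (0/9 proved); BetaPertH ⇐ (D1) ∧ (D4) ∧ CAP+tail; G-an2-4 gates asym, D1 and NE2/3/4.

THE POINT (census sense (α); the COMPARISON column, conjecture (E58′)).  (E58b)'s profile condition reads `Σ_k x_k ≤ 1` (`Q ≤ 2`); the column's numerics
(`HOME/b2b-balaban-beta-d4-p2/g51/e58/`, `g60/e70/README.md`) say the TOTAL load of a realizable profile is small on dense towers (`≤ 0.84` in every simulated
flow; saturated ratio-2 towers `0.77` at height 12) and exceeds `1` only through astronomically separated ages («`n` hyper-separated ages give `≈ n·q⋆`»).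
This file quantifies it along ANY trajectory: `Σ_{k≤n} x_k ≤ (√2∕2)(1 + log ρ_n)` with `ρ_n = ((F_n − F_0)∕n)∕(F_1 − F_0)` the growth of the cube secant slope
— `O(1)` where the levels grow like `m^{2∕3}` (memory-dominated: `F` linear), `≈ ½·log n` where they grow like `m` (floor-dominated).  With (E70a)'s exponent
sandwich `θ ∈ [2∕3, 1]`: total load is the integrated EXCESS of the level exponent over `2∕3`, and only floor-dominated gaps make room for more than `≈ 0.71`
of load.  NOT CLAIMED: any comparison theorem; anything printed.

WHAT IS PROVED ([folklore]; 0 `def`, 0 sorry; abstract positive sequences `p` with `p_{m+1}² − p_m² = b + Σ_{k<K} L_k∕p_{m+1+k}`, then `MemFlow`).  §1 `pflow_strictMono`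
(`b > 0`), `sq_double_le` (`p_{2m}² ≤ 2p_m² − p_0²`), `sum_shift_le_sum_range` (supported loads), **`cumMass_le`** (`Σ_{k≤m} L_k ≤ √2·(p_m³ − p_0³)∕m`, `m ≥ 1`),
`secant_mono` (`(p_k³ − p_0³)∕k` non-decreasing).  §2 `abel_invariant` (`Σ_{k≤n} L_k·k∕(p_k³−p_0³) − (Σ_{k≤n}L_k)·n∕(p_n³−p_0³) ≤ √2·log ρ_n`), **`totalLoad_le`**.
§3 **`totalLoad_le_of_memFlow`**.
-/
noncomputable section
open Finset

namespace Summit.QuantumFields.BalabanUV.Beta.EriceRemainderEnclosureHistoryAutonomyComparisonTotalLoad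

open Literature.MathematicalPhysics.QuantumFieldTheory.Balaban1983to89
open Literature.MathematicalPhysics.QuantumFieldTheory.Balaban1983to89.T4BetaFlowWellPosed
open Summit.QuantumFields.BalabanUV.Beta.EriceRemainderEnclosureHistoryAutonomyComparisonInvCubeConvex
  (mono_of_pflow sq_incr_anti sq_incr_nonneg cube_secant pflow_of_memFlow)

variable {b : ℝ} {L : ℕ → ℝ} {K : ℕ} {p h : ℕ → ℝ} {y : ℝ}

/-! ## §1 Cumulative acceleration and the monotone secant -/

/-- With a positive floor the sequence is strictly increasing. [folklore] -/
theorem pflow_strictMono (hb : 0 < b) (hL : ∀ k, 0 ≤ L k) (hp : ∀ j, 0 < p j)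
    (hflow : ∀ m, p (m + 1) ^ 2 - p m ^ 2 = b + ∑ k ∈ range K, L k / p (m + 1 + k)) : StrictMono p := by
  refine strictMono_nat_of_lt_succ fun m => ?_
  have h : 0 < p (m + 1) ^ 2 - p m ^ 2 := by
    rw [hflow m]; exact add_pos_of_pos_of_nonneg hb (sum_nonneg fun k _ => div_nonneg (hL k) (hp _).le)
  exact (pow_lt_pow_iff_left₀ (hp m).le (hp (m + 1)).le two_ne_zero).mp (by linarith)

/-- Doubling the scale at most doubles the level: `p_{2m}² ≤ 2p_m² − p_0²` (the `m` increments after scale `m` are each at most the matching one before). [folklore] -/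
theorem sq_double_le (hb : 0 ≤ b) (hL : ∀ k, 0 ≤ L k) (hp : ∀ j, 0 < p j)
    (hflow : ∀ m, p (m + 1) ^ 2 - p m ^ 2 = b + ∑ k ∈ range K, L k / p (m + 1 + k)) (m : ℕ) :
    p (2 * m) ^ 2 ≤ 2 * p m ^ 2 - p 0 ^ 2 := by
  have h1 : ∑ i ∈ range m, (p (i + 1) ^ 2 - p i ^ 2) = p m ^ 2 - p 0 ^ 2 := sum_range_sub (fun i => p i ^ 2) m
  have h2 : ∑ i ∈ range m, (p (m + i + 1) ^ 2 - p (m + i) ^ 2) = p (2 * m) ^ 2 - p m ^ 2 := by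
    have := sum_range_sub (fun i => p (m + i) ^ 2) m
    simpa [two_mul, add_assoc] using this
  have h3 : ∑ i ∈ range m, (p (m + i + 1) ^ 2 - p (m + i) ^ 2) ≤ ∑ i ∈ range m, (p (i + 1) ^ 2 - p i ^ 2) :=
    sum_le_sum fun i _ => sq_incr_anti hb hL hp hflow (by omega)
  linarith

/-- Loads supported below `K`: a shifted window sum of `L_k·g_k` (`g ≥ 0`) is at most the full profile sum. [folklore] -/
theorem sum_shift_le_sum_range (hL : ∀ k, 0 ≤ L k) (hLK : ∀ k, K ≤ k → L k = 0) {g : ℕ → ℝ} (hg : ∀ k, 0 ≤ g k) (m : ℕ) :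
    ∑ i ∈ range m, L (i + 1) * g (i + 1) ≤ ∑ k ∈ range K, L k * g k := by
  classical
  -- the image of `range m` under `i ↦ i+1` inside `range (max K (m+1))`
  have hsub : ∑ i ∈ range m, L (i + 1) * g (i + 1) = ∑ k ∈ (range m).map ⟨(· + 1), add_left_injective 1⟩, L k * g k := by
    rw [sum_map]; rfl
  rw [hsub]
  have hbig : ∑ k ∈ range K, L k * g k = ∑ k ∈ range (max K (m + 1)), L k * g k := by
    rw [← sum_range_add_sum_Ico _ (le_max_left K (m + 1))]
    have : ∑ k ∈ Ico K (max K (m + 1)), L k * g k = 0 :=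
      sum_eq_zero fun k hk => by rw [hLK k (mem_Ico.mp hk).1, zero_mul]
    rw [this, add_zero]
  rw [hbig]
  refine sum_le_sum_of_subset_of_nonneg ?_ fun k _ _ => mul_nonneg (hL k) (hg k)
  intro k hk
  rw [mem_map] at hk
  obtain ⟨i, hi, rfl⟩ := hk
  simp only [Function.Embedding.coeFn_mk, mem_range] at hi ⊢
  omega

/-- **CUMULATIVE ACCELERATION**: `Σ_{k≤m} L_k ≤ √2·(p_m³ − p_0³)∕m` for every `m ≥ 1` (`b > 0`, `L ≥ 0` supported below `K`).  The `m` increments below scale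
`m` are each at least the last one, which reads every age `k ≤ m` at `p_{m+k} ≤ p_{2m} ≤ √2·p_m`. [folklore] -/
theorem cumMass_le (hb : 0 < b) (hL : ∀ k, 0 ≤ L k) (hLK : ∀ k, K ≤ k → L k = 0) (hp : ∀ j, 0 < p j)
    (hflow : ∀ m, p (m + 1) ^ 2 - p m ^ 2 = b + ∑ k ∈ range K, L k / p (m + 1 + k)) {m : ℕ} (hm : 1 ≤ m) :
    ∑ i ∈ range m, L (i + 1) ≤ Real.sqrt 2 * (p m ^ 3 - p 0 ^ 3) / m := by
  have hmono := mono_of_pflow hb.le hL hp hflow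
  have hmr : (0 : ℝ) < m := by exact_mod_cast hm
  have hP0 := hp 0; have hPm := hp m; have hP2 := hp (2 * m)
  -- the last increment below m reads every age ≤ m at p_{m+k} ≤ p_{2m}
  obtain ⟨m', rfl⟩ : ∃ m', m = m' + 1 := ⟨m - 1, by omega⟩
  have hinc : (∑ i ∈ range (m' + 1), L (i + 1)) / p (2 * (m' + 1)) ≤ p (m' + 1) ^ 2 - p m' ^ 2 := by
    rw [hflow m', sum_div]
    have h1 : ∑ i ∈ range (m' + 1), L (i + 1) / p (2 * (m' + 1)) ≤ ∑ i ∈ range (m' + 1), L (i + 1) * (1 / p (m' + 1 + (i + 1))) := by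
      refine sum_le_sum fun i hi => ?_
      rw [div_eq_mul_one_div]
      refine mul_le_mul_of_nonneg_left ?_ (hL _)
      exact one_div_le_one_div_of_le (hp _) (hmono (by have := mem_range.mp hi; omega))
    have h2 := sum_shift_le_sum_range hL hLK (g := fun k => 1 / p (m' + 1 + k)) (fun k => by have := hp (m' + 1 + k); positivity) (m' + 1)
    have h3 : ∑ k ∈ range K, L k * (1 / p (m' + 1 + k)) = ∑ k ∈ range K, L k / p (m' + 1 + k) :=
      sum_congr rfl fun k _ => by rw [← div_eq_mul_one_div]
    linarith [h1, h2, h3]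
  -- the m increments below m are each ≥ the last one
  have hlev : (m' + 1 : ℝ) * (p (m' + 1) ^ 2 - p m' ^ 2) ≤ p (m' + 1) ^ 2 - p 0 ^ 2 := by
    have htel : ∑ i ∈ range (m' + 1), (p (i + 1) ^ 2 - p i ^ 2) = p (m' + 1) ^ 2 - p 0 ^ 2 := sum_range_sub (fun i => p i ^ 2) (m' + 1)
    have : ∑ _i ∈ range (m' + 1), (p (m' + 1) ^ 2 - p m' ^ 2) ≤ ∑ i ∈ range (m' + 1), (p (i + 1) ^ 2 - p i ^ 2) :=
      sum_le_sum fun i hi => sq_incr_anti hb.le hL hp hflow (by have := mem_range.mp hi; omega)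
    rw [sum_const, card_range, nsmul_eq_mul, htel] at this
    exact_mod_cast this
  -- p_{2m} ≤ √2 p_m
  have h2m : p (2 * (m' + 1)) ≤ Real.sqrt 2 * p (m' + 1) := by
    have hsq := sq_double_le hb.le hL hp hflow (m' + 1)
    have h0 : p (2 * (m' + 1)) ^ 2 ≤ (Real.sqrt 2 * p (m' + 1)) ^ 2 := by
      rw [mul_pow, Real.sq_sqrt (by norm_num : (0:ℝ) ≤ 2)]; nlinarith [sq_nonneg (p 0)]
    exact (pow_le_pow_iff_left₀ hP2.le (by positivity) two_ne_zero).mp h0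
  -- assemble: Λ ≤ (p_m² − p_0²) p_{2m} / m ≤ √2 (p_m² − p_0²) p_m / m ≤ √2 (p_m³ − p_0³)/m
  have hΛ0 : 0 ≤ ∑ i ∈ range (m' + 1), L (i + 1) := sum_nonneg fun i _ => hL _
  have hA : ∑ i ∈ range (m' + 1), L (i + 1) ≤ (p (m' + 1) ^ 2 - p m' ^ 2) * p (2 * (m' + 1)) := by
    have := (div_le_iff₀ hP2).mp hinc
    linarith
  have hB : (p (m' + 1) ^ 2 - p m' ^ 2) * p (2 * (m' + 1)) * (m' + 1 : ℝ) ≤ (p (m' + 1) ^ 2 - p 0 ^ 2) * (Real.sqrt 2 * p (m' + 1)) := by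
    have hi0 : 0 ≤ p (m' + 1) ^ 2 - p m' ^ 2 := sq_incr_nonneg hb.le hL hp hflow m'
    have hd0 : 0 ≤ p (m' + 1) ^ 2 - p 0 ^ 2 := by nlinarith
    calc (p (m' + 1) ^ 2 - p m' ^ 2) * p (2 * (m' + 1)) * (m' + 1 : ℝ)
        = ((m' + 1 : ℝ) * (p (m' + 1) ^ 2 - p m' ^ 2)) * p (2 * (m' + 1)) := by ring
      _ ≤ (p (m' + 1) ^ 2 - p 0 ^ 2) * p (2 * (m' + 1)) := mul_le_mul_of_nonneg_right hlev hP2.le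
      _ ≤ (p (m' + 1) ^ 2 - p 0 ^ 2) * (Real.sqrt 2 * p (m' + 1)) := mul_le_mul_of_nonneg_left h2m hd0
  have hC : (p (m' + 1) ^ 2 - p 0 ^ 2) * p (m' + 1) ≤ p (m' + 1) ^ 3 - p 0 ^ 3 := by
    have h01 : p 0 ≤ p (m' + 1) := hmono (Nat.zero_le _)
    nlinarith [mul_nonneg (mul_nonneg hP0.le hP0.le) (sub_nonneg.2 h01)]
  rw [le_div_iff₀ hmr]
  push_cast
  have hs2 : 0 ≤ Real.sqrt 2 := Real.sqrt_nonneg 2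
  nlinarith [hA, hB, hC, mul_le_mul_of_nonneg_left hC hs2, hP2]

/-- **THE CUBE SECANT SLOPE IS NON-DECREASING**: `(p_k³ − p_0³)∕k ≤ (p_{k+1}³ − p_0³)∕(k+1)` for `k ≥ 1` — (E70a) `cube_secant` with one extra scale. [folklore] -/
theorem secant_mono (hb : 0 ≤ b) (hL : ∀ k, 0 ≤ L k) (hp : ∀ j, 0 < p j)
    (hflow : ∀ m, p (m + 1) ^ 2 - p m ^ 2 = b + ∑ k ∈ range K, L k / p (m + 1 + k)) {k : ℕ} (hk : 1 ≤ k) :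
    (p k ^ 3 - p 0 ^ 3) / k ≤ (p (k + 1) ^ 3 - p 0 ^ 3) / (k + 1) := by
  have hkr : (0 : ℝ) < k := by exact_mod_cast hk
  have hsec := cube_secant hb hL hp hflow k 1
  push_cast at hsec
  rw [div_le_div_iff₀ hkr (by positivity)]
  nlinarith [hsec]

/-! ## §2 Abel summation against the secant: the total load -/

/-- **THE ABEL INVARIANT.**  For `n ≥ 1`, with `Λ_n = Σ_{k≤n} L_k` and the secant slopes `s_k = (p_k³ − p_0³)∕k` (positive, non-decreasing):
`Σ_{k≤n} L_k∕s_k − Λ_n∕s_n ≤ √2·log(s_n∕s_1)`.  Induction: the increment of the left side is `Λ_n(1∕s_n − 1∕s_{n+1}) ≤ √2·(1 − s_n∕s_{n+1}) ≤ √2·log(s_{n+1}∕s_n)`.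
[folklore] -/
theorem abel_invariant (hb : 0 < b) (hL : ∀ k, 0 ≤ L k) (hLK : ∀ k, K ≤ k → L k = 0) (hp : ∀ j, 0 < p j)
    (hflow : ∀ m, p (m + 1) ^ 2 - p m ^ 2 = b + ∑ k ∈ range K, L k / p (m + 1 + k)) {n : ℕ} (hn : 1 ≤ n) :
    ∑ i ∈ range n, L (i + 1) / ((p (i + 1) ^ 3 - p 0 ^ 3) / (i + 1)) - (∑ i ∈ range n, L (i + 1)) / ((p n ^ 3 - p 0 ^ 3) / n) ≤
      Real.sqrt 2 * Real.log (((p n ^ 3 - p 0 ^ 3) / n) / (p 1 ^ 3 - p 0 ^ 3)) := by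
  have hsm := pflow_strictMono hb hL hp hflow
  -- positivity of the secant slopes
  have hcube : ∀ k : ℕ, 1 ≤ k → 0 < p k ^ 3 - p 0 ^ 3 := fun k hk => by
    have hlt : p 0 < p k := hsm (by omega)
    have : p 0 ^ 3 < p k ^ 3 := pow_lt_pow_left₀ hlt (hp 0).le (by norm_num)
    linarith
  have hspos : ∀ k : ℕ, 1 ≤ k → 0 < (p k ^ 3 - p 0 ^ 3) / k := fun k hk =>
    div_pos (hcube k hk) (by exact_mod_cast hk)
  induction n with
  | zero => exact absurd hn (by omega)
  | succ n ih =>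
    rcases Nat.eq_zero_or_pos n with hn0 | hnpos
    · -- base n + 1 = 1
      subst hn0
      have hs1 := hcube 1 le_rfl
      simp only [sum_range_one, Nat.cast_zero, zero_add, Nat.cast_one, div_one]
      rw [sub_self, div_self hs1.ne', Real.log_one, mul_zero]
    · have ih' := ih hnpos
      have hsNpos : 0 < (p n ^ 3 - p 0 ^ 3) / (n : ℝ) := hspos n hnpos
      have hsN1pos : 0 < (p (n + 1) ^ 3 - p 0 ^ 3) / ((n : ℝ) + 1) := by
        have := hspos (n + 1) (by omega); push_cast at this; exact this
      have hs1pos : 0 < p 1 ^ 3 - p 0 ^ 3 := hcube 1 le_rfl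
      have hmono : (p n ^ 3 - p 0 ^ 3) / (n : ℝ) ≤ (p (n + 1) ^ 3 - p 0 ^ 3) / ((n : ℝ) + 1) :=
        secant_mono hb.le hL hp hflow hnpos
      have hΛle : ∑ i ∈ range n, L (i + 1) ≤ Real.sqrt 2 * ((p n ^ 3 - p 0 ^ 3) / n) := by
        have := cumMass_le hb hL hLK hp hflow hnpos
        rwa [mul_div_assoc] at this
      -- name the pieces
      obtain ⟨Λ, hΛ⟩ : ∃ Λ, ∑ i ∈ range n, L (i + 1) = Λ := ⟨_, rfl⟩
      obtain ⟨sN, hsN⟩ : ∃ s, (p n ^ 3 - p 0 ^ 3) / (n : ℝ) = s := ⟨_, rfl⟩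
      obtain ⟨sN1, hsN1⟩ : ∃ s, (p (n + 1) ^ 3 - p 0 ^ 3) / ((n : ℝ) + 1) = s := ⟨_, rfl⟩
      obtain ⟨s1, hs1⟩ : ∃ s, p 1 ^ 3 - p 0 ^ 3 = s := ⟨_, rfl⟩
      rw [hΛ, hsN, hs1] at ih'
      rw [hΛ, hsN] at hΛle
      rw [hsN, hsN1] at hmono
      rw [hsN] at hsNpos
      rw [hsN1] at hsN1pos
      rw [hs1] at hs1pos
      rw [sum_range_succ, sum_range_succ]
      push_cast
      rw [hΛ, hsN1, hs1]
      -- increment bound: Λ (1/sN − 1/sN1) ≤ √2 (1 − sN/sN1) ≤ √2 log (sN1/sN)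
      have hstep : Λ / sN - Λ / sN1 ≤ Real.sqrt 2 * Real.log (sN1 / sN) := by
        have h1 : Λ / sN - Λ / sN1 = Λ * (1 / sN - 1 / sN1) := by ring
        have h2 : 0 ≤ 1 / sN - 1 / sN1 := by
          rw [sub_nonneg]; exact one_div_le_one_div_of_le hsNpos hmono
        have h3 : Λ * (1 / sN - 1 / sN1) ≤ Real.sqrt 2 * sN * (1 / sN - 1 / sN1) := mul_le_mul_of_nonneg_right hΛle h2
        have h4 : sN * (1 / sN - 1 / sN1) = 1 - (sN1 / sN)⁻¹ := by field_simp
        have h5 : 1 - (sN1 / sN)⁻¹ ≤ Real.log (sN1 / sN) := Real.one_sub_inv_le_log_of_pos (div_pos hsN1pos hsNpos)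
        have hs2 : 0 ≤ Real.sqrt 2 := Real.sqrt_nonneg 2
        calc Λ / sN - Λ / sN1 = Λ * (1 / sN - 1 / sN1) := h1
          _ ≤ Real.sqrt 2 * (sN * (1 / sN - 1 / sN1)) := by rw [← mul_assoc]; exact h3
          _ ≤ Real.sqrt 2 * Real.log (sN1 / sN) := by rw [h4]; exact mul_le_mul_of_nonneg_left h5 hs2
      -- logs: log(sN1/s1) = log(sN/s1) + log(sN1/sN)
      have hlog : Real.log (sN1 / s1) = Real.log (sN / s1) + Real.log (sN1 / sN) := by
        rw [← Real.log_mul (div_pos hsNpos hs1pos).ne' (div_pos hsN1pos hsNpos).ne']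
        congr 1; field_simp
      have e : L (n + 1) / sN1 - (Λ + L (n + 1)) / sN1 = -(Λ / sN1) := by ring
      rw [hlog]
      linarith [ih', hstep, e]

/-- **THE TOTAL LOAD IS THE LOGARITHM OF THE CUBE-SECANT GROWTH.**  Along a positive sequence with `p_{m+1}² − p_m² = b + Σ_{k<K} L_k∕p_{m+1+k}` (`b > 0`,
`L ≥ 0` supported below `K`), for every `n ≥ 1`: **`Σ_{1≤k≤n} L_k·k∕(2p_k³) ≤ (√2∕2)·(1 + log( ((p_n³ − p_0³)∕n) ∕ (p_1³ − p_0³) ))`**. [folklore] -/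
theorem totalLoad_le (hb : 0 < b) (hL : ∀ k, 0 ≤ L k) (hLK : ∀ k, K ≤ k → L k = 0) (hp : ∀ j, 0 < p j)
    (hflow : ∀ m, p (m + 1) ^ 2 - p m ^ 2 = b + ∑ k ∈ range K, L k / p (m + 1 + k)) {n : ℕ} (hn : 1 ≤ n) :
    ∑ i ∈ range n, L (i + 1) * (i + 1) / (2 * p (i + 1) ^ 3) ≤
      Real.sqrt 2 / 2 * (1 + Real.log (((p n ^ 3 - p 0 ^ 3) / n) / (p 1 ^ 3 - p 0 ^ 3))) := by
  have hsm := pflow_strictMono hb hL hp hflow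
  have habel := abel_invariant hb hL hLK hp hflow hn
  have hspos : ∀ k : ℕ, 1 ≤ k → 0 < p k ^ 3 - p 0 ^ 3 := fun k hk => by
    have hlt : p 0 < p k := hsm (by omega)
    have : p 0 ^ 3 < p k ^ 3 := pow_lt_pow_left₀ hlt (hp 0).le (by norm_num)
    linarith
  -- each load term: L k · k/(2p_k³) ≤ (1/2)·L k /((p_k³ − p_0³)/k)
  have hterm : ∀ i ∈ range n, L (i + 1) * (i + 1) / (2 * p (i + 1) ^ 3) ≤ (1 / 2) * (L (i + 1) / ((p (i + 1) ^ 3 - p 0 ^ 3) / (i + 1))) := by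
    intro i _
    have hk := hspos (i + 1) (by omega)
    have hp3 : 0 < p (i + 1) ^ 3 := pow_pos (hp _) 3
    have hi0 : (0 : ℝ) < i + 1 := by positivity
    have hA : 0 ≤ L (i + 1) * (i + 1) := mul_nonneg (hL _) hi0.le
    have hDP : p (i + 1) ^ 3 - p 0 ^ 3 ≤ p (i + 1) ^ 3 := by nlinarith [pow_pos (hp 0) 3]
    have e : (1 / 2) * (L (i + 1) / ((p (i + 1) ^ 3 - p 0 ^ 3) / (i + 1))) = L (i + 1) * (i + 1) / (2 * (p (i + 1) ^ 3 - p 0 ^ 3)) := by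
      field_simp
    rw [e]
    exact div_le_div_of_nonneg_left hA (by positivity) (by linarith)
  have hsum := sum_le_sum hterm
  rw [← mul_sum] at hsum
  -- the Λ-part: Λ_n / s_n ≤ √2
  have hΛ : (∑ i ∈ range n, L (i + 1)) / ((p n ^ 3 - p 0 ^ 3) / n) ≤ Real.sqrt 2 := by
    have hs : 0 < (p n ^ 3 - p 0 ^ 3) / n := div_pos (hspos n hn) (by exact_mod_cast hn)
    rw [div_le_iff₀ hs]
    have := cumMass_le hb hL hLK hp hflow hn
    rwa [mul_div_assoc] at this
  linarith [habel, hΛ, hsum]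

/-! ## §3 Box solutions of the flow -/

/-- **THE TOTAL LOAD ALONG A BOX SOLUTION**: for the affine memory `B(u) = b + Σ_{k<K} L_k·u_k` (`b > 0`, `L ≥ 0` with `L_k = 0` for `k ≥ K`), every positive
solution `h` from any pin and every `n ≥ 1`: `Σ_{1≤k≤n} L_k·k·h_k³∕2 ≤ (√2∕2)·(1 + log( ((1∕h_n³ − 1∕h_0³)∕n) ∕ (1∕h_1³ − 1∕h_0³) ))`. [folklore] -/
theorem totalLoad_le_of_memFlow (hb : 0 < b) (hL : ∀ k, 0 ≤ L k) (hLK : ∀ k, K ≤ k → L k = 0) (hpos : ∀ j, 0 < h j)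
    (hf : MemFlow (fun u : ℕ → ℝ => b + ∑ k ∈ range K, L k * u k) y h) {n : ℕ} (hn : 1 ≤ n) :
    ∑ i ∈ range n, L (i + 1) * (i + 1) * h (i + 1) ^ 3 / 2 ≤
      Real.sqrt 2 / 2 * (1 + Real.log (((1 / h n ^ 3 - 1 / h 0 ^ 3) / n) / (1 / h 1 ^ 3 - 1 / h 0 ^ 3))) := by
  have hp : ∀ j, 0 < 1 / h j := fun j => one_div_pos.2 (hpos j)
  have := totalLoad_le hb hL hLK hp (pflow_of_memFlow hf) hn
  simp only [one_div_pow] at this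
  have e : ∀ i ∈ range n, L (i + 1) * (i + 1) * h (i + 1) ^ 3 / 2 = L (i + 1) * (i + 1) / (2 * (1 / h (i + 1) ^ 3)) := by
    intro i _; have := hpos (i + 1); field_simp
  rw [sum_congr rfl e]
  exact this

end Summit.QuantumFields.BalabanUV.Beta.EriceRemainderEnclosureHistoryAutonomyComparisonTotalLoad

end
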